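import Literature.ModelTheory.FiniteModelTheory.ColouringCodes
import Literature.ModelTheory.FiniteModelTheory.ClosedSetStructure
import Literature.RingTheory.MvPolynomial.TriangularSubstitution
import HarnessLib

/-!
# Reducibility for closed sets: the reduction lemma of Conneryd–de Rezende–Nordström–Pang–Risse
# in monic-exponent form (Conneryd–Ghannane–Pang 2025, Lemma 6.8 = [CdRNPR25, Lemma 6.5])

Topic `Literature/ModelTheory/FiniteModelTheory`.  Bottom-up formalisation of the named fact
`connerydGhannanePang2025_thm_6_1` (arXiv:2511.17272, Thm. 6.1).  We PROVE the reducibility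
hypothesis `hred` of `graphCohomologicallyKConsistent_of_reducible`
(`CohomologicalConsistencyIdealReduction.lean`) for CLOSED sets in sparse bounded-degree graphs:

**`monicExponents_of_isClosed`.** Let `G` be linearly ordered, `(ℓ, ε)`-sparse with all degrees
`≤ Δ` and `ε(Δ+1) < 1/2`; let the variables `x_{v,i}` be numbered by `enc` so that LARGER vertices
get MORE significant (smaller-index) variables; let `|X| ≤ ℓ` and `J` closed (Def. 6.6; `J ⊆ X` is not needed).
Then every exponent `α` supported on the variables of `J` which is the leading exponent of a monic
integer polynomial vanishing on the codes `𝒱_X` is the leading exponent of a monic integer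
polynomial vanishing on `𝒱_J`.

Printed statement (CGP Lemma 6.8 = [CdRNPR25, Lemma 6.5]): for `W ⊆ U`, `W` closed, `|U| ≤ ℓ`
(and a degree condition), a monomial with vertices in `W` is reducible modulo `⟨U⟩` iff modulo
`⟨W⟩`, for any admissible order respecting `≺_V`; we prove the pure-lex, integral (monic
witness) form that the `ℤ`-version of the operator needs, following the PROOF printed in the
FOCS 2023 version of [CdRNPR] (Lemmas 4.6 and 5.4): take `f ∈ I(𝒱_X)` monic with leading exponent
`α`; RESTRICT the variables of `A = X ∖ (J ∪ N)` to the monochromatic-star `3`-colouring `ρ` of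
`ClosedSetStructure.lean` and SUBSTITUTE, for each `v ∈ N` with its unique smaller neighbour
`u ∈ J` and star colour `κ v`, `x_{v,κ v} ↦ 0`, `x_{v,κ v+2} ↦ x_{u,κ v+1}`,
`x_{v,κ v+1} ↦ 1 - x_{u,κ v+1}` (`subst`).  Semantically this is a CODE EXTENSION `𝒱_J → 𝒱_X`
(`codeExt_mem_pts`: the neighbours in `X` of `v ∈ N` are `u` and its leaves, of colour `κ v`),
so the substituted polynomial vanishes on `𝒱_J` (`eval_bind₁_apply`); and the substitution is
triangular and fixes the `J`-variables, so the result is monic with the same leading exponent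
(`degree_bind₁_eq` of `TriangularSubstitution.lean`) — "each monomial affected by the
substitution decreases in the induced order … `m` is the leading term of `f*`".

## References

* [ConnerydGhannanePang2025] arXiv:2511.17272, Lemma 6.8, Def. 6.6. READ.
* J. Conneryd, S. F. de Rezende, J. Nordström, S. Pang, K. Risse, *Graph Colouring Is Hard on
  Average for Polynomial Calculus and Nullstellensatz*, FOCS 2023, proofs of Lemmas 4.6 and 5.4.
  READ (galaxy pdf:3983998057739619720); = [CdRNPR25] of the source (full version).
-/

noncomputable section

open MvPolynomial Finset
open scoped MonomialOrder
open Literature.RingTheory.MvPolynomial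

namespace Literature.ModelTheory.FiniteModelTheory

namespace ConnerydGhannanePang

variable {V : Type*} [LinearOrder V] {G : SimpleGraph V} [DecidableRel G.Adj] {J X : Finset V}
  {N : ℕ} {enc : V × Fin 3 ≃ Fin N}

/-! ### Three colours -/

/-- In `Fin 3`, `k + 1 ≠ k`. [folklore] -/
theorem fin3_add_one_ne (k : Fin 3) : k + 1 ≠ k := by fin_cases k <;> decide

/-- In `Fin 3`, `k + 2 ≠ k`. [folklore] -/
theorem fin3_add_two_ne (k : Fin 3) : k + 2 ≠ k := by fin_cases k <;> decide

/-- In `Fin 3`, `k + 1 ≠ k + 2`. [folklore] -/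
theorem fin3_add_one_ne_add_two (k : Fin 3) : k + 1 ≠ k + 2 := by fin_cases k <;> decide

/-- The three elements of `Fin 3` are `k, k+1, k+2`. [folklore] -/
theorem fin3_cases (k i : Fin 3) : i = k ∨ i = k + 1 ∨ i = k + 2 := by
  fin_cases k <;> fin_cases i <;> decide

/-! ### The substitution -/

variable (G J X enc) in
/-- THE SUBSTITUTION of the reduction lemma (given the star colouring `ρ, κ`): identity on the
variables of `J` and of the vertices outside `N ∪ A`; the `A`-variables go to the constants
`[ρ z = i]`; for `v ∈ N` with smaller `J`-neighbour `u = uOf v` and star colour `κ v`: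
`x_{v,κ v+1} ↦ 1 - x_{u,κ v+1}`, `x_{v,κ v+2} ↦ x_{u,κ v+1}`, `x_{v,κ v} ↦ 0`.
[cite: ConnerydGhannanePang2025, Lemma 6.8 (proof via [CdRNPR25, Lemma 6.5]: (4.6))] -/
def subst (ρ κ : V → Fin 3) (j : Fin N) : MvPolynomial (Fin N) ℤ :=
  if (enc.symm j).1 ∈ nbr G J X then
    (if (enc.symm j).2 = κ (enc.symm j).1 + 1 then
        1 - MvPolynomial.X (enc (uOf G J (enc.symm j).1, κ (enc.symm j).1 + 1))
      else if (enc.symm j).2 = κ (enc.symm j).1 + 2 then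
        MvPolynomial.X (enc (uOf G J (enc.symm j).1, κ (enc.symm j).1 + 1))
      else 0)
  else if (enc.symm j).1 ∈ far G J X then C (if ρ (enc.symm j).1 = (enc.symm j).2 then 1 else 0)
  else MvPolynomial.X j

variable {ρ κ : V → Fin 3}

/-- `subst` on a variable of `N`. [folklore] -/
theorem subst_nbr {v : V} (hv : v ∈ nbr G J X) (i : Fin 3) :
    subst G J X enc ρ κ (enc (v, i)) =
      if i = κ v + 1 then 1 - MvPolynomial.X (enc (uOf G J v, κ v + 1))
      else if i = κ v + 2 then MvPolynomial.X (enc (uOf G J v, κ v + 1)) else 0 := by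
  simp only [subst, Equiv.symm_apply_apply, hv, if_true]

/-- `subst` on a variable of `A`. [folklore] -/
theorem subst_far {z : V} (hz : z ∈ far G J X) (i : Fin 3) :
    subst G J X enc ρ κ (enc (z, i)) = C (if ρ z = i then 1 else 0) := by
  have hzN : z ∉ nbr G J X := fun h => not_mem_far_of_mem_nbr h hz
  simp only [subst, Equiv.symm_apply_apply, hz, hzN, if_true, if_false]

/-- `subst` on the other variables (in particular those of `J`). [folklore] -/
theorem subst_other {z : V} (hzN : z ∉ nbr G J X) (hzA : z ∉ far G J X) (i : Fin 3) :
    subst G J X enc ρ κ (enc (z, i)) = MvPolynomial.X (enc (z, i)) := by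
  simp only [subst, Equiv.symm_apply_apply, hzN, hzA, if_false]

/-- Vertices of `J` are neither in `N` nor in `A`. [folklore] -/
theorem not_mem_nbr_of_mem {z : V} (hz : z ∈ J) : z ∉ nbr G J X := fun h => (mem_nbr.1 h).2.1 hz

/-- Vertices of `J` are neither in `N` nor in `A`. [folklore] -/
theorem not_mem_far_of_mem {z : V} (hz : z ∈ J) : z ∉ far G J X := fun h => (mem_far.1 h).2.1 hz

/-- **The substitution is triangular** for the lexicographic order, provided larger vertices
have more significant variables (`u = uOf v < v`). [cite: ConnerydGhannanePang2025, Lemma 6.8 (proof)] -/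
theorem isTriangular_subst (hJ : IsClosed G J)
    (henc : ∀ u v : V, u < v → ∀ i j : Fin 3, enc (v, i) < enc (u, j)) :
    IsTriangular MonomialOrder.lex (subst G J X enc ρ κ) := by
  intro j
  obtain ⟨⟨z, i⟩, rfl⟩ := enc.surjective j
  by_cases hzN : z ∈ nbr G J X
  · rw [subst_nbr hzN]
    have hlt : Finsupp.single (enc (uOf G J z, κ z + 1)) 1 ≼[MonomialOrder.lex]
        Finsupp.single (enc (z, i)) 1 :=
      le_of_lt (lex_single_lt_single (henc _ _ (uOf_lt hJ hzN) i _))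
    split_ifs
    · exact degree_one_sub_X_le_single hlt
    · exact degree_X_le_single_of_le hlt
    · rw [← C_0]; exact degree_C_le_single _ _
  · by_cases hzA : z ∈ far G J X
    · rw [subst_far hzA]; exact degree_C_le_single _ _
    · rw [subst_other hzN hzA]; exact degree_X_le_single _

/-! ### The code extension `𝒱_J → 𝒱_X` -/

variable (G J X enc ρ κ) in
/-- The point `j ↦ σ_j(y)`: the code of the colouring of `X` extending the code `y` of a
colouring of `J` (keep `J` and the free coordinates, colour `A` by `ρ`, and `v ∈ N` by
`κ v + 2` if `u` has colour `κ v + 1`, else by `κ v + 1`). [cite: ConnerydGhannanePang2025, Lemma 6.8 (proof)] -/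
def codeExt (y : Fin N → ℤ) : Fin N → ℤ :=
  fun j => eval y (subst G J X enc ρ κ j)

/-- `codeExt` on `N`. [folklore] -/
theorem codeExt_nbr (y : Fin N → ℤ) {v : V} (hv : v ∈ nbr G J X) (i : Fin 3) :
    codeExt G J X enc ρ κ y (enc (v, i)) =
      if i = κ v + 1 then 1 - y (enc (uOf G J v, κ v + 1))
      else if i = κ v + 2 then y (enc (uOf G J v, κ v + 1)) else 0 := by
  unfold codeExt
  rw [subst_nbr hv]
  split_ifs <;> simp

/-- `codeExt` on `A`. [folklore] -/
theorem codeExt_far (y : Fin N → ℤ) {z : V} (hz : z ∈ far G J X) (i : Fin 3) :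
    codeExt G J X enc ρ κ y (enc (z, i)) = if ρ z = i then 1 else 0 := by
  unfold codeExt
  rw [subst_far hz, eval_C]

/-- `codeExt` elsewhere. [folklore] -/
theorem codeExt_other (y : Fin N → ℤ) {z : V} (hzN : z ∉ nbr G J X) (hzA : z ∉ far G J X) (i : Fin 3) :
    codeExt G J X enc ρ κ y (enc (z, i)) = y (enc (z, i)) := by
  unfold codeExt
  rw [subst_other hzN hzA, eval_X]

/-- On `N` exactly one indicator is `1`: the colour of `v` is `κ v + 2` if `u` has colour
`κ v + 1` and `κ v + 1` otherwise. [folklore] -/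
theorem codeExt_nbr_eq_one_iff (y : Fin N → ℤ) {v : V} (hv : v ∈ nbr G J X) (i : Fin 3) :
    codeExt G J X enc ρ κ y (enc (v, i)) = 1 ↔
      (i = κ v + 1 ∧ y (enc (uOf G J v, κ v + 1)) = 0) ∨
        (i = κ v + 2 ∧ y (enc (uOf G J v, κ v + 1)) = 1) := by
  rw [codeExt_nbr y hv]
  have h12 := fin3_add_one_ne_add_two (κ v)
  have h1 := fin3_add_one_ne (κ v)
  have h2 := fin3_add_two_ne (κ v)
  rcases fin3_cases (κ v) i with rfl | rfl | rfl
  · rw [if_neg h1.symm, if_neg h2.symm]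
    simp [h1.symm, h2.symm]
  · rw [if_pos rfl]
    simp only [true_and, h12, false_and, or_false, sub_eq_self]
  · rw [if_neg h12.symm, if_pos rfl]
    simp only [h12.symm, false_and, false_or, true_and]

/-- **The code extension lands in `𝒱_X`**: for a code `y` of a proper colouring of `J`,
`codeExt y` codes a proper colouring of `X` (zones: `J` from `y`; `A` by `ρ`, proper and with no
edges to `J`; `v ∈ N` differs from its unique `J`-neighbour `u` and from its leaves, which have
colour `κ v`; `N` is independent). [cite: ConnerydGhannanePang2025, Lemma 6.8 (proof via [CdRNPR25, Lemma 6.5])] -/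
theorem codeExt_mem_pts (hJ : IsClosed G J)
    (hρ : ∀ z ∈ far G J X, ∀ z' ∈ far G J X, G.Adj z z' → ρ z ≠ ρ z')
    (hκ : ∀ v ∈ nbr G J X, ∀ w ∈ leaves G J X v, ρ w = κ v)
    {y : Fin N → ℤ} (hy : y ∈ pts G enc J) : codeExt G J X enc ρ κ y ∈ pts G enc X := by
  obtain ⟨h01, hcode, hedge⟩ := mem_pts.1 hy
  have h01' : ∀ j, codeExt G J X enc ρ κ y j = 0 ∨ codeExt G J X enc ρ κ y j = 1 := by
    intro j
    obtain ⟨⟨z, i⟩, rfl⟩ := enc.surjective j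
    by_cases hzN : z ∈ nbr G J X
    · rw [codeExt_nbr y hzN]
      rcases h01 (enc (uOf G J z, κ z + 1)) with h | h <;> · rw [h]; split_ifs <;> simp
    · by_cases hzA : z ∈ far G J X
      · rw [codeExt_far y hzA]; split_ifs <;> simp
      · rw [codeExt_other y hzN hzA]; exact h01 _
  -- the zones of a vertex of `X`
  have hzone : ∀ {z}, z ∈ X → z ∈ J ∨ z ∈ nbr G J X ∨ z ∈ far G J X := by
    intro z hz
    by_cases hzJ : z ∈ J
    · exact Or.inl hzJ
    · exact Or.inr (mem_nbr_or_mem_far (G := G) hz hzJ)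
  refine mem_pts.2 ⟨h01', fun w hw => ?_, fun w hw w' hw' hadj i hi hi' => ?_⟩
  · -- exactly one colour
    rcases hzone hw with hwJ | hwN | hwA
    · have hN := not_mem_nbr_of_mem (G := G) (X := X) hwJ
      have hA := not_mem_far_of_mem (G := G) (X := X) hwJ
      simp_rw [codeExt_other y hN hA]
      exact hcode w hwJ
    · simp_rw [codeExt_nbr_eq_one_iff y hwN]
      rcases h01 (enc (uOf G J w, κ w + 1)) with h0 | h1
      · refine ⟨κ w + 1, Or.inl ⟨rfl, h0⟩, fun i hi => ?_⟩
        rcases hi with ⟨hi, -⟩ | ⟨-, hi⟩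
        · exact hi
        · rw [h0] at hi; exact absurd hi zero_ne_one
      · refine ⟨κ w + 2, Or.inr ⟨rfl, h1⟩, fun i hi => ?_⟩
        rcases hi with ⟨-, hi⟩ | ⟨hi, -⟩
        · rw [h1] at hi; exact absurd hi one_ne_zero
        · exact hi
    · simp_rw [codeExt_far y hwA]
      refine ⟨ρ w, ?_, fun i hi => ?_⟩
      · show (if ρ w = ρ w then (1 : ℤ) else 0) = 1
        rw [if_pos rfl]
      · have hi : (if ρ w = i then (1 : ℤ) else 0) = 1 := hi
        by_contra hne
        rw [if_neg (Ne.symm hne)] at hi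
        exact zero_ne_one hi
  · -- no monochromatic edge: by zones of `w` and `w'`
    -- the `J`–`N` case, both orientations
    have hJN : ∀ {a b : V}, a ∈ J → b ∈ nbr G J X → G.Adj a b → ∀ i,
        codeExt G J X enc ρ κ y (enc (a, i)) = 1 → codeExt G J X enc ρ κ y (enc (b, i)) = 1 →
          False := by
      intro a b ha hb hab i ha1 hb1
      rw [codeExt_other y (not_mem_nbr_of_mem ha) (not_mem_far_of_mem ha)] at ha1
      have hau : a = uOf G J b := eq_uOf hJ hb ha hab
      rw [codeExt_nbr_eq_one_iff y hb] at hb1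
      rcases hb1 with ⟨rfl, h0⟩ | ⟨rfl, h1⟩
      · rw [← hau] at h0
        rw [h0] at ha1
        exact zero_ne_one ha1
      · rw [← hau] at h1
        exact zero_ne_one ((code_eq_zero_of_ne hy ha h1 (fin3_add_one_ne_add_two (κ b)).symm).symm.trans
          ha1)
    -- the `N`–`A` case, both orientations
    have hNA : ∀ {a b : V}, a ∈ nbr G J X → b ∈ far G J X → G.Adj a b → ∀ i,
        codeExt G J X enc ρ κ y (enc (a, i)) = 1 → codeExt G J X enc ρ κ y (enc (b, i)) = 1 →
          False := by
      intro a b ha hb hab i ha1 hb1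
      rw [codeExt_far y hb] at hb1
      have hρb : ρ b = i := by by_contra h; rw [if_neg h] at hb1; exact zero_ne_one hb1
      have hbleaf : b ∈ leaves G J X a := mem_leaves.2 ⟨hb, hab⟩
      have hi : i = κ a := hρb.symm.trans (hκ a ha b hbleaf)
      rw [codeExt_nbr_eq_one_iff y ha] at ha1
      rcases ha1 with ⟨h, -⟩ | ⟨h, -⟩
      · exact fin3_add_one_ne (κ a) (h.symm.trans hi)
      · exact fin3_add_two_ne (κ a) (h.symm.trans hi)
    rcases hzone hw with hwJ | hwN | hwA <;> rcases hzone hw' with hw'J | hw'N | hw'A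
    · rw [codeExt_other y (not_mem_nbr_of_mem hwJ) (not_mem_far_of_mem hwJ)] at hi
      rw [codeExt_other y (not_mem_nbr_of_mem hw'J) (not_mem_far_of_mem hw'J)] at hi'
      exact hedge w hwJ w' hw'J hadj i hi hi'
    · exact hJN hwJ hw'N hadj i hi hi'
    · exact not_adj_of_mem_far hw'A hwJ hadj
    · exact hJN hw'J hwN hadj.symm i hi' hi
    · exact nbr_independent hJ hwN hw'N hadj
    · exact hNA hwN hw'A hadj i hi hi'
    · exact not_adj_of_mem_far hwA hw'J hadj.symm
    · exact hNA hw'N hwA hadj.symm i hi' hi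
    · rw [codeExt_far y hwA] at hi
      rw [codeExt_far y hw'A] at hi'
      have h1 : ρ w = i := by by_contra h; rw [if_neg h] at hi; exact zero_ne_one hi
      have h2 : ρ w' = i := by by_contra h; rw [if_neg h] at hi'; exact zero_ne_one hi'
      exact hρ w hwA w' hw'A hadj (h1.trans h2.symm)

/-! ### The reduction lemma -/

/-- **Reducibility for closed sets** (Conneryd–Ghannane–Pang Lemma 6.8 = [CdRNPR25, Lemma 6.5],
integral lexicographic form).  `G` linearly ordered, `(ℓ, ε)`-sparse, degrees `≤ Δ`,
`ε(Δ+1) < 1/2`; variables numbered so that larger vertices are more significant; `|X| ≤ ℓ`,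
`J` closed (`J ⊆ X` is not even needed).  Then a `J`-supported leading exponent of a monic integer polynomial
vanishing on `𝒱_X` is one of a monic integer polynomial vanishing on `𝒱_J`.
[cite: ConnerydGhannanePang2025, Lemma 6.8] -/
theorem monicExponents_of_isClosed [Fintype V] (hJ : IsClosed G J)
    (henc : ∀ u v : V, u < v → ∀ i j : Fin 3, enc (v, i) < enc (u, j))
    {ℓ : ℕ} {ε : ℝ} (hε : 0 ≤ ε) (hG : IsSparse G ℓ ε) (hX : X.card ≤ ℓ) {Δ : ℕ}
    (hΔ : ∀ v, G.degree v ≤ Δ) (hεΔ : ε * (Δ + 1) < 1 / 2)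
    {α : Fin N →₀ ℕ} (hαJ : ∀ j ∈ α.support, (enc.symm j).1 ∈ J)
    (hα : α ∈ monicExponents (pts G enc X)) : α ∈ monicExponents (pts G enc J) := by
  obtain ⟨ρ, κ, hρ, hκ⟩ := exists_starColouring (X := X) hJ hε hG hX hΔ hεΔ
  obtain ⟨f, hfX, hmon, hdeg⟩ := hα
  have hσ := isTriangular_subst (X := X) (enc := enc) (ρ := ρ) (κ := κ) hJ henc
  have hfix : ∀ j ∈ (MonomialOrder.lex.degree f).support, subst G J X enc ρ κ j = MvPolynomial.X j := by
    intro j hj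
    rw [hdeg] at hj
    obtain ⟨⟨z, i⟩, rfl⟩ := enc.surjective j
    have hz : z ∈ J := by simpa using hαJ _ hj
    exact subst_other (not_mem_nbr_of_mem hz) (not_mem_far_of_mem hz) i
  obtain ⟨hdeg', hmon'⟩ := degree_bind₁_eq hσ hmon hfix
  refine ⟨bind₁ (subst G J X enc ρ κ) f, fun y hy => ?_, hmon', hdeg'.trans hdeg⟩
  rw [eval_bind₁_apply]
  exact hfX _ (codeExt_mem_pts hJ hρ hκ hy)

end ConnerydGhannanePang

end Literature.ModelTheory.FiniteModelTheory
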